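import Summits.KontsevichZagierPeriods.KontsevichZagierPeriods.Theorems.GammaHodgeSector.Negative.LoadBearing
import Literature.NumberTheory.Transcendental.SemialgebraicLineDeriv
import Literature.NumberTheory.Transcendental.KZProduct
import Summits.KontsevichZagierPeriods.KontsevichZagierPeriods.Theses.CompiledSubstitutions

/-!
# `GammaHodgeSector` (stmt-KontsevichZagierPeriods-3742) — negative side IV: certified
non-vacuity, the calibration instance

Landed copy of §5 of `Cruxes/GammaHodgeSector/Disproof.lean`: the hypotheses of the crux hold
simultaneously for the non-degenerate instance `(N,N',k) = (1,0,1)`, `x = y = ½`, `c = 1`,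
`r = arcsineRep = [(0,1), t^{−1/2}(1−t)^{−1/2}]` (value `B(½,½) = π`), `r' = discRep =
[open unit disc, 1]` (value `π`) — `calibration_hypotheses`; hence
`GammaHodgeSector → arcsineRep ~ discRep` (`calibration_of_gammaHodgeSector`), which after
`t = (1+x)/2` is Kontsevich–Zagier's own §1.1 example `∫_{−1}^{1} dx/√(1−x²) = π`, and which is
the instance `a = ½` of item stmt-KontsevichZagierPeriods-3383 `EulerReflectionRational`
(`calibration_of_eulerReflectionRational`, through `equivalent_piRep_discRep :
[closed disc, 1] ~ [open disc, 1]`).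
-/

noncomputable section

open MeasureTheory Set
open scoped BigOperators

namespace Summit.KontsevichZagierPeriods.GammaHodgeSectorNegative

open Literature.NumberTheory.Transcendental
open Literature.NumberTheory.Transcendental.KZ
open Literature.ModelTheory.ExponentialFields (IsSemialgebraic isSemialgebraic_univ)
open Summit.KontsevichZagierPeriods.KontsevichZagierPeriods.Theses.TerasomaMultiplication (GammaHodgeSector)

/-! ## §5 Non-vacuity, certified: the calibration instance is KZ's own §1.1 example

`(N, N', k) = (1, 0, 1)`, `x = y = ½`, `c = 1`: the hypotheses of the crux hold for
`r = [(0,1), t^{−1/2}(1−t)^{−1/2}]` (`arcsineRep`, value `B(½,½) = π`) and `r' = [open unit disc, 1]`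
(`discRep`, value `π`), all checked below (`calibration_hypotheses`). So the crux asserts in
particular `arcsineRep ~ discRep` (`calibration_of_gammaHodgeSector`) — after the affine change
`t = (1+x)/2` this is literally KZ 2001 §1.1, `∫_{−1}^{1} dx/√(1−x²) = π`: a 4–5 move chain
(rule 2 affine; KZ's Newton–Leibniz identity `2√(1−x²) − 1/√(1−x²) = (x√(1−x²))'`; rule 3 for
the area under `±√(1−x²)`; rule 1). This is the smallest non-degenerate instance and the natural
first target for a prover; it is NOT claimed here. -/

section Calibration

open Literature.ModelTheory.ExponentialFields (isSemialgebraic_setOf_eval_pos)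

/-- The real beta integrand `x^{α−1}(1−x)^{β−1}` is integrable on `(0,1)` with integral `B(α, β)`
(read off from Mathlib's normalised beta density `ProbabilityTheory.lintegral_betaPDF_eq_one`;
a copy of the tree's private lemma in `KontsevichZagier.lean`). [folklore] -/
theorem integrableOn_betaIntegrand_and_integral_eq {α β : ℝ} (hα : 0 < α) (hβ : 0 < β) :
    IntegrableOn (fun x : ℝ => x ^ (α - 1) * (1 - x) ^ (β - 1)) (Ioo 0 1) ∧
      ∫ x in Ioo (0 : ℝ) 1, x ^ (α - 1) * (1 - x) ^ (β - 1) = ProbabilityTheory.beta α β := by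
  have hc0 : 0 < ProbabilityTheory.beta α β := ProbabilityTheory.beta_pos hα hβ
  set g : ℝ → ℝ := fun x => 1 / ProbabilityTheory.beta α β * x ^ (α - 1) * (1 - x) ^ (β - 1)
    with hg
  have hlin : ∫⁻ x in Ioo (0 : ℝ) 1, ENNReal.ofReal (g x) = 1 := by
    rw [hg, ← ProbabilityTheory.lintegral_betaPDF, ProbabilityTheory.lintegral_betaPDF_eq_one hα hβ]
  have hg0 : 0 ≤ᵐ[volume.restrict (Ioo (0 : ℝ) 1)] g := by
    refine ae_restrict_of_forall_mem measurableSet_Ioo fun x hx => ?_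
    have h1 : 0 ≤ x ^ (α - 1) := Real.rpow_nonneg hx.1.le _
    have h2 : 0 ≤ (1 - x) ^ (β - 1) := Real.rpow_nonneg (by linarith [hx.2]) _
    simp only [hg, Pi.zero_apply]
    exact mul_nonneg (mul_nonneg (by positivity) h1) h2
  have hgm : AEStronglyMeasurable g (volume.restrict (Ioo (0 : ℝ) 1)) :=
    Measurable.aestronglyMeasurable (by fun_prop)
  have hgi : Integrable g (volume.restrict (Ioo (0 : ℝ) 1)) :=
    ⟨hgm, (hasFiniteIntegral_iff_ofReal hg0).2 (by simp [hlin])⟩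
  have hgint : ∫ x in Ioo (0 : ℝ) 1, g x = 1 := by
    rw [integral_eq_lintegral_of_nonneg_ae hg0 hgm, hlin]; simp
  have hfg : (fun x : ℝ => x ^ (α - 1) * (1 - x) ^ (β - 1)) =
      fun x => ProbabilityTheory.beta α β * g x := by
    funext x
    simp only [hg]
    field_simp
  refine ⟨?_, ?_⟩
  · rw [hfg]; exact hgi.const_mul _
  · rw [hfg, integral_const_mul, hgint, mul_one]

/-- `B(½, ½) = π` (`Γ(½)² / Γ(1)`). [folklore] -/
theorem beta_half_half : ProbabilityTheory.beta (1 / 2) (1 / 2) = Real.pi := by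
  rw [ProbabilityTheory.beta, Real.Gamma_one_half_eq, show (1 / 2 : ℝ) + 1 / 2 = 1 by norm_num,
    Real.Gamma_one, div_one, Real.mul_self_sqrt Real.pi_pos.le]

/-- The open unit interval `(0,1) ⊆ ℝ¹`, in the crux's form `{t | ∀ j, t j ∈ (0,1)}`. -/
def unitIntervalDomain : Set (Fin 1 → ℝ) := {t | ∀ j : Fin 1, t j ∈ Ioo (0:ℝ) 1}

/-- Membership in `unitIntervalDomain`. [folklore] -/
theorem mem_unitIntervalDomain {t : Fin 1 → ℝ} : t ∈ unitIntervalDomain ↔ t 0 ∈ Ioo (0:ℝ) 1 := by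
  simp [unitIntervalDomain, Fin.forall_fin_one]

/-- `unitIntervalDomain` is the preimage of `(0,1)` under `ℝ¹ ≃ ℝ`. [folklore] -/
theorem unitIntervalDomain_eq_preimage :
    unitIntervalDomain = (MeasurableEquiv.funUnique (Fin 1) ℝ) ⁻¹' Ioo 0 1 := by
  ext t
  rw [mem_unitIntervalDomain, mem_preimage]
  simp [MeasurableEquiv.funUnique]

/-- `unitIntervalDomain` is `ℚ`-semialgebraic (`0 < X₀`, `0 < 1 − X₀`). [folklore] -/
theorem isSemialgebraic_unitIntervalDomain : IsSemialgebraic ℚ unitIntervalDomain := by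
  have h1 := isSemialgebraic_setOf_eval_pos (k := ℚ) (R := ℝ) (MvPolynomial.X 0 : MvPolynomial (Fin 1) ℚ)
  have h2 := isSemialgebraic_setOf_eval_pos (k := ℚ) (R := ℝ)
    (1 - MvPolynomial.X 0 : MvPolynomial (Fin 1) ℚ)
  convert h1.inter h2 using 1
  ext t
  simp [mem_unitIntervalDomain, sub_pos]

/-- `unitIntervalDomain` is measurable. [folklore] -/
theorem measurableSet_unitIntervalDomain : MeasurableSet unitIntervalDomain := by
  rw [unitIntervalDomain_eq_preimage]
  exact (MeasurableEquiv.funUnique (Fin 1) ℝ).measurable measurableSet_Ioo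

/-- The arcsine integrand `t^{−1/2}(1−t)^{−1/2}` on `ℝ¹`. [folklore] -/
def arcsineFun (t : Fin 1 → ℝ) : ℝ := (t 0) ^ (-(1 / 2 : ℝ)) * (1 - t 0) ^ (-(1 / 2 : ℝ))

/-- On `(0,1)`: `t^{−1/2}(1−t)^{−1/2} = 1/√(t(1−t))`. [folklore] -/
theorem arcsineFun_eq_inv_sqrt {t : Fin 1 → ℝ} (ht : t ∈ unitIntervalDomain) :
    arcsineFun t = (Real.sqrt (t 0 * (1 - t 0)))⁻¹ := by
  rw [mem_unitIntervalDomain] at ht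
  have h0 : 0 ≤ t 0 := ht.1.le
  have h1 : 0 ≤ 1 - t 0 := by linarith [ht.2]
  rw [arcsineFun, Real.sqrt_mul h0, mul_inv, Real.sqrt_eq_rpow, Real.sqrt_eq_rpow,
    Real.rpow_neg h0, Real.rpow_neg h1]

/-- The arcsine integrand is `ℚ`-semialgebraic on `(0,1)` (graph of `1/√(X₀(1−X₀))`; the tree's
closure lemmas `fun_mul`, `fun_sqrt`, `fun_inv`). [folklore] -/
theorem isSemialgebraicFunOn_arcsineFun : IsSemialgebraicFunOn ℚ unitIntervalDomain arcsineFun := by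
  have hW := isSemialgebraic_unitIntervalDomain
  have hx : IsSemialgebraicFunOn ℚ unitIntervalDomain (fun t => t 0) :=
    (isSemialgebraicFunOn_aeval hW (MvPolynomial.X 0)).congr fun t _ => by simp
  have h1x : IsSemialgebraicFunOn ℚ unitIntervalDomain (fun t => 1 - t 0) :=
    (isSemialgebraicFunOn_aeval hW (1 - MvPolynomial.X 0)).congr fun t _ => by simp
  exact ((hx.fun_mul h1x).fun_sqrt.fun_inv).congr fun t ht => (arcsineFun_eq_inv_sqrt ht).symm

/-- The arcsine integrand is the beta integrand `(½, ½)` transported along `ℝ¹ ≃ ℝ`. [folklore] -/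
theorem arcsineFun_eq_comp :
    arcsineFun = (fun x : ℝ => x ^ ((1 / 2 : ℝ) - 1) * (1 - x) ^ ((1 / 2 : ℝ) - 1)) ∘
      (MeasurableEquiv.funUnique (Fin 1) ℝ) := by
  funext t
  simp only [arcsineFun, Function.comp_apply]
  rw [show ((1 / 2 : ℝ) - 1) = -(1 / 2) by norm_num]
  simp [MeasurableEquiv.funUnique]

/-- The arcsine integrand is integrable on `(0,1)`. [folklore] -/
theorem integrableOn_arcsineFun : IntegrableOn arcsineFun unitIntervalDomain := by
  have h := (integrableOn_betaIntegrand_and_integral_eq (α := 1 / 2) (β := 1 / 2)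
    (by norm_num) (by norm_num)).1
  rw [unitIntervalDomain_eq_preimage, arcsineFun_eq_comp]
  exact ((volume_preserving_funUnique (Fin 1) ℝ).integrableOn_comp_preimage
    (MeasurableEquiv.measurableEmbedding _)).mpr h

/-- `∫_{(0,1)} t^{−1/2}(1−t)^{−1/2} dt = π`. [folklore] -/
theorem setIntegral_arcsineFun : ∫ t in unitIntervalDomain, arcsineFun t = Real.pi := by
  have h := (integrableOn_betaIntegrand_and_integral_eq (α := 1 / 2) (β := 1 / 2)
    (by norm_num) (by norm_num)).2
  rw [beta_half_half] at h
  rw [unitIntervalDomain_eq_preimage, arcsineFun_eq_comp, ← h]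
  exact (volume_preserving_funUnique (Fin 1) ℝ).setIntegral_preimage_emb
    (MeasurableEquiv.measurableEmbedding _)
    (fun x : ℝ => x ^ ((1 / 2 : ℝ) - 1) * (1 - x) ^ ((1 / 2 : ℝ) - 1)) (Ioo 0 1)

/-- **The arcsine representation** `[(0,1), t^{−1/2}(1−t)^{−1/2}]` (the cube representation of
the crux at `N = 1`, `x = y = ½`). -/
def arcsineRep : IntegralRep 1 where
  domain := unitIntervalDomain
  integrand := arcsineFun
  isSemialgebraic_domain := isSemialgebraic_unitIntervalDomain
  isSemialgebraicFunOn_integrand := isSemialgebraicFunOn_arcsineFun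
  integrableOn := integrableOn_arcsineFun

/-- `value arcsineRep = π` (`= B(½,½)`). [cite: KontsevichZagier2001, §1.1] -/
theorem arcsineRep_value : arcsineRep.value = Real.pi := setIntegral_arcsineFun

/-- The open unit disc `{z₀² + z₁² < 1} ⊆ ℝ²`. -/
def unitDisc : Set (Fin 2 → ℝ) := {z | z 0 ^ 2 + z 1 ^ 2 < 1}

/-- The open unit disc is `ℚ`-semialgebraic. [folklore] -/
theorem isSemialgebraic_unitDisc : IsSemialgebraic ℚ unitDisc := by
  have h := isSemialgebraic_setOf_eval_pos (k := ℚ) (R := ℝ)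
    (1 - MvPolynomial.X 0 ^ 2 - MvPolynomial.X 1 ^ 2 : MvPolynomial (Fin 2) ℚ)
  convert h using 1
  ext z
  simp only [unitDisc, mem_setOf_eq, map_sub, map_one, map_pow, MvPolynomial.aeval_X]
  constructor <;> intro hz <;> linarith

/-- The open unit disc is open, hence measurable. [folklore] -/
theorem measurableSet_unitDisc : MeasurableSet unitDisc :=
  (isOpen_lt (by fun_prop) continuous_const).measurableSet

/-- **Area of the open unit disc** `= π` (transported from `Complex.volume_ball`). [folklore] -/
theorem volume_unitDisc : volume unitDisc = ENNReal.ofReal Real.pi := by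
  have hpre : Complex.measurableEquivPi ⁻¹' unitDisc = Metric.ball (0 : ℂ) 1 := by
    ext a
    rw [mem_preimage, Complex.measurableEquivPi_apply, mem_ball_zero_iff,
      ← sq_lt_one_iff₀ (norm_nonneg a), Complex.sq_norm, Complex.normSq_apply]
    simp [sq, unitDisc]
  rw [← Complex.volume_preserving_equiv_pi.measure_preimage
    measurableSet_unitDisc.nullMeasurableSet, hpre, Complex.volume_ball,
    ← NNReal.coe_real_pi, ENNReal.ofReal_coe_nnreal]
  simp

/-- **The disc representation** `[open unit disc, 1]` (the ball × cube representation of the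
crux at `k = 1`, `N' = 0`, `c = 1`). -/
def discRep : IntegralRep 2 where
  domain := unitDisc
  integrand := fun _ => 1
  isSemialgebraic_domain := isSemialgebraic_unitDisc
  isSemialgebraicFunOn_integrand := by
    simpa using isSemialgebraicFunOn_aeval isSemialgebraic_unitDisc (1 : MvPolynomial (Fin 2) ℚ)
  integrableOn := integrableOn_const (by simp [volume_unitDisc])

/-- `value discRep = π`. [cite: KontsevichZagier2001, §1.1 eq. (1)] -/
theorem discRep_value : discRep.value = Real.pi := by
  rw [IntegralRep.value, show discRep.domain = unitDisc from rfl,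
    show discRep.integrand = fun _ => (1 : ℝ) from rfl, setIntegral_const, measureReal_def,
    volume_unitDisc, ENNReal.toReal_ofReal Real.pi_pos.le, smul_eq_mul, mul_one]

/-- `{u/2} = ½` for odd `u`. [folklore] -/
theorem fract_odd_mul_half {u : ℕ} (hu : Odd u) : Int.fract ((u : ℚ) * (1 / 2)) = 1 / 2 := by
  obtain ⟨m, rfl⟩ := hu
  have : (((2 * m + 1 : ℕ) : ℚ) * (1 / 2)) = ((m : ℤ) : ℚ) + 1 / 2 := by push_cast; ring
  rw [this, Int.fract_intCast_add, Int.fract_eq_self.mpr ⟨by norm_num, by norm_num⟩]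

/-- **All hypotheses of the crux hold for the calibration instance** `(N,N',k) = (1,0,1)`,
`x = y = ½`, `c = 1`, `r = arcsineRep`, `r' = discRep` (admissibility; the Hodge-type test: for
odd `u`, `{u/2} + {u/2} − {u} = 1 = k`; `1` algebraic; the two pinnings; value equality
`π = π`). Certified non-vacuity of a non-degenerate instance. [folklore] -/
theorem calibration_hypotheses :
    Admissible (fun _ : Fin 1 => (1 / 2 : ℚ)) (fun _ => 1 / 2) ∧
    Admissible (N := 0) Fin.elim0 Fin.elim0 ∧
    HodgeCondition 1 0 1 (fun _ => (1 / 2 : ℚ)) (fun _ => 1 / 2) Fin.elim0 Fin.elim0 ∧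
    IsAlgebraic ℚ (1 : ℝ) ∧
    IsCubeBetaRep (fun _ : Fin 1 => (1 / 2 : ℚ)) (fun _ => 1 / 2) arcsineRep ∧
    IsBallCubeRep (N' := 0) 1 Fin.elim0 Fin.elim0 1 discRep ∧
    arcsineRep.value = discRep.value := by
  have hfr : Int.fract (1 / 2 : ℚ) = 1 / 2 := Int.fract_eq_self.mpr ⟨by norm_num, by norm_num⟩
  have hden : (1 / 2 : ℚ).den = 2 := by rw [one_div, Rat.inv_ofNat_den]
  refine ⟨fun _ => ⟨by norm_num, by norm_num, by rw [hfr]; norm_num, by rw [hfr]; norm_num⟩,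
    admissible_elim0, ?_, isAlgebraic_one, ?_, ?_, ?_⟩
  · -- the Hodge-type test
    intro u _ hcop _
    have hodd : Odd u := Nat.coprime_two_right.mp (hden ▸ (hcop 0).1)
    have hsum : Int.fract ((u : ℚ) * (1 / 2 + 1 / 2)) = 0 := by
      rw [show (1 / 2 : ℚ) + 1 / 2 = 1 by norm_num, mul_one, Int.fract_natCast]
    simp only [hodgeSum, Finset.univ_unique, Fin.default_eq_zero, Finset.sum_singleton,
      fract_odd_mul_half hodd, hsum, Finset.univ_eq_empty, Finset.sum_empty]
    norm_num
  · -- `arcsineRep` is the cube representation at `x = y = ½`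
    refine ⟨rfl, fun t _ => ?_⟩
    simp only [arcsineRep, arcsineFun, Fin.prod_univ_one]
    push_cast
    norm_num
  · -- `discRep` is the ball × cube representation at `k = 1`, `N' = 0`, `c = 1`
    refine ⟨?_, fun z _ => ?_⟩
    · ext z
      simp [discRep, unitDisc, Fin.sum_univ_two]
    · simp [discRep]
  · rw [arcsineRep_value, discRep_value]

/-- **The crux contains KZ's §1.1 example**: `GammaHodgeSector → arcsineRep ~ discRep`
(`∫₀¹ dt/√(t(1−t))` versus the area of the unit disc). The natural first target for a prover
(a 4–5 move chain after `t = (1+x)/2`; not claimed here). [cite: KontsevichZagier2001, §1.1] -/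
theorem calibration_of_gammaHodgeSector (h : GammaHodgeSector) : Equivalent arcsineRep discRep := by
  obtain ⟨hx, hx', hH, halg, hr, hr', hv⟩ := calibration_hypotheses
  exact (gammaHodgeSector_iff.mp h) 1 0 1 _ _ _ _ 1 hx hx' hH halg arcsineRep discRep hr hr' hv

/-! ### The calibration instance is the instance `a = ½` of `EulerReflectionRational`
(stmt-KontsevichZagierPeriods-3383, route CompiledSubstitutions), up to the null unit circle -/

/-- The unit circle `{z₀² + z₁² = 1} ⊆ ℝ²`. -/
def unitCircle : Set (Fin 2 → ℝ) := {z | z 0 ^ 2 + z 1 ^ 2 = 1}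

/-- The unit circle is `ℚ`-semialgebraic. [folklore] -/
theorem isSemialgebraic_unitCircle : IsSemialgebraic ℚ unitCircle := by
  have h := Literature.ModelTheory.ExponentialFields.isSemialgebraic_setOf_eval_eq_zero (k := ℚ) (R := ℝ)
    (MvPolynomial.X 0 ^ 2 + MvPolynomial.X 1 ^ 2 - 1 : MvPolynomial (Fin 2) ℚ)
  convert h using 1
  ext z
  simp only [unitCircle, mem_setOf_eq, map_sub, map_add, map_one, map_pow, MvPolynomial.aeval_X,
    sub_eq_zero]

/-- The closed disc is the open disc plus the circle. [folklore] -/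
theorem piDisc_eq_union : piDisc = unitDisc ∪ unitCircle := by
  ext z
  simp only [mem_piDisc, unitDisc, unitCircle, mem_union, mem_setOf_eq]
  exact le_iff_lt_or_eq

/-- The unit circle is the closed disc minus the open disc. [folklore] -/
theorem unitCircle_eq_diff : unitCircle = piDisc \ unitDisc := by
  ext z
  simp only [mem_piDisc, unitDisc, unitCircle, mem_sdiff, mem_setOf_eq, not_lt]
  constructor
  · intro h
    exact ⟨h.le, h.ge⟩
  · intro h
    exact le_antisymm h.1 h.2

/-- **The unit circle is Lebesgue-null** (`π − π`, from the two disc areas). [folklore] -/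
theorem volume_unitCircle : volume unitCircle = 0 := by
  have hsub : unitDisc ⊆ piDisc := fun z hz => le_of_lt (α := ℝ) hz
  rw [unitCircle_eq_diff, measure_sdiff hsub measurableSet_unitDisc.nullMeasurableSet
    (by simp [volume_unitDisc]), volume_piDisc, volume_unitDisc, tsub_self]

/-- The circle representation `[unit circle, 1]` (a null representation). -/
def circleRep : IntegralRep 2 where
  domain := unitCircle
  integrand := fun _ => 1
  isSemialgebraic_domain := isSemialgebraic_unitCircle
  isSemialgebraicFunOn_integrand := by
    simpa using isSemialgebraicFunOn_aeval isSemialgebraic_unitCircle (1 : MvPolynomial (Fin 2) ℚ)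
  integrableOn := integrableOn_const (by simp [volume_unitCircle])

/-- A representation on a null domain is a relation (domain additivity `σ = σ ∪ σ`). [folklore] -/
theorem of_circleRep_mem_relations : KZ.of circleRep ∈ relations := by
  have h : KZ.of circleRep - KZ.of circleRep - KZ.of circleRep ∈ domainAddRel :=
    ⟨2, circleRep, circleRep, circleRep, (union_self _).symm, by simp [circleRep, volume_unitCircle],
      fun _ _ => rfl, fun _ _ => rfl, rfl⟩
  have h' := relations.neg_mem (domainAddRel_subset_relations h)
  convert h' using 1
  abel

/-- **`[closed disc, 1] ~ [open disc, 1]`** (one domain-additivity move along the null circle, plus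
the null circle representation). [folklore] -/
theorem equivalent_piRep_discRep : Equivalent piRep discRep := by
  have h : KZ.of piRep - KZ.of discRep - KZ.of circleRep ∈ domainAddRel :=
    ⟨2, piRep, discRep, circleRep, piDisc_eq_union, ?_, fun _ _ => rfl, fun _ _ => rfl, rfl⟩
  · have h1 := domainAddRel_subset_relations h
    have h2 := of_circleRep_mem_relations
    have : KZ.of piRep - KZ.of discRep =
        (KZ.of piRep - KZ.of discRep - KZ.of circleRep) + KZ.of circleRep := by abel
    show KZ.of piRep - KZ.of discRep ∈ relations
    rw [this]
    exact relations.add_mem h1 h2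
  · refine measure_mono_null (fun z hz => hz.2) ?_
    exact volume_unitCircle

open Summit.KontsevichZagierPeriods.KontsevichZagierPeriods.Theses.CompiledSubstitutions (EulerReflectionRational) in
/-- **The calibration instance is the instance `a = ½` of `EulerReflectionRational`**
(stmt-KontsevichZagierPeriods-3383, route CompiledSubstitutions: `[sin(πa) x^{a−1}(1−x)^{−a}] ~
[closed unit disc, 1]`): with `sin(π/2) = 1` and `[closed disc] ~ [open disc]` it gives
`arcsineRep ~ discRep`. So the smallest instance of `GammaHodgeSector` is shared with item 3383;
more generally the whole slice `N = 1, N' = 0, x + y = 1` of the reflection sector is 3383 scaled by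
the algebraic constant `1/sin(πx)`. [folklore] -/
theorem calibration_of_eulerReflectionRational (h : EulerReflectionRational) :
    Equivalent arcsineRep discRep := by
  have hr : arcsineRep.domain = {x | x 0 ∈ Ioo (0:ℝ) 1} := by
    ext t
    exact mem_unitIntervalDomain
  have hi : EqOn arcsineRep.integrand
      (fun x => Real.sin (Real.pi * (1 / 2 : ℚ)) * (x 0) ^ (((1 / 2 : ℚ) : ℝ) - 1) *
        (1 - x 0) ^ (-((1 / 2 : ℚ) : ℝ))) arcsineRep.domain := by
    intro t _
    have hsin : Real.sin (Real.pi * (1 / 2 : ℚ)) = 1 := by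
      rw [show (Real.pi * (1 / 2 : ℚ) : ℝ) = Real.pi / 2 by push_cast; ring, Real.sin_pi_div_two]
    simp only [arcsineRep, arcsineFun, hsin, one_mul]
    push_cast
    norm_num
  have h1 : Equivalent arcsineRep piRep :=
    h (1 / 2) (by norm_num) (by norm_num) arcsineRep piRep hr hi rfl (fun _ _ => rfl)
  exact h1.trans equivalent_piRep_discRep

end Calibration


end Summit.KontsevichZagierPeriods.GammaHodgeSectorNegative
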